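import Literature.AlgebraicGeometry.Frobenioids.Prop55SubStandardClosers
import Literature.AlgebraicGeometry.Frobenioids.RealificationNonDilating
import HarnessLib

/-!
# Frobenioids I, Proposition 5.5 (iii), "Finally" (standard type) — closer with (N) discharged

Mochizuki, *The geometry of Frobenioids I: the general theory*, Kyushu J. Math. **62** (2008)
293–400, §5, Proposition 5.5 (iii) p. 104 ll. 37–39 / proof p. 105 ll. 22–27. [cite: MochizukiFrdI2008, Prop. 5.5 (iii) p.104]

Proof-only appendix to `Prop55SubStandardClosers.lean` (cell abc-iut, sub-DAG S7 row
`FrdI:Prop5.5(iii)/P55-L07`, seat abc-iut-w4-d084): of the two realification inputs of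
`FrdI.Prop55Sub.prop55iii_untr_rlf_standard_of`, (N) "`Φ` non-dilating ⇒ `Φ^rlf` non-dilating" is now
the theorem `isNonDilatingOn_rlfFunctor` (`RealificationNonDilating.lean`), so the named statement
`Prop55iii_untr_rlf_standard` holds MODULO (H) alone — the standing hypotheses of Thm. 5.2 for THE
realified data `(Φ^rlf, ℝ · Φ^birat)` ([FrdI] Prop. 5.3: "`Φ^rlf` is a divisorial monoid on `D`",
"`ℝ · Φ^birat` group-like"; sub-DAG W3 of the cell), kept as a hypothesis, NOT a new fact.
No statement of the paper is strengthened; nothing here bears on [IUTchIII] Cor. 3.12.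
-/

namespace Literature.AlgebraicGeometry.Frobenioids

open CategoryTheory Opposite

universe w v v' u u'

namespace FrdI.Prop55Sub

open PreFrobenioid
open PreFrobenioidData (ofFunctor)
open Literature.AnabelianGeometry.EtaleTheta (rlfFunctor)

variable {D : Type u} [Category.{v} D] {Φ : Dᵒᵖ ⥤ CommMonCat.{w}} {C : Type u'}
  [Category.{v'} C] (F : C ⥤ ElemFrobenioid Φ)

/-- **Proposition 5.5 (iii), "Finally", standard type — the named statement
`Prop55iii_untr_rlf_standard` MODULO (H) alone**: the standing hypotheses of Thm. 5.2 for THE realified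
data `(Φ^rlf, ℝ · Φ^birat)` (Prop. 5.3). The `C^un-tr` conjunct is unconditional
(`isOfStandardType_untr'`); for `C^rlf`, Thm. 5.2 (iii) right to left at the realified data: (a) is
vacuous (`Φ^rlf ≠ 0` since `C` is not of group-like type and `Φ → Φ^rlf` is injective), (b) `D` is of
FSMFF-type and (c) `Φ^rlf` is non-dilating because `Φ` is (`isNonDilatingOn_rlfFunctor`).
[cite: MochizukiFrdI2008, Prop. 5.5 (iii) p.104] -/
theorem prop55iii_untr_rlf_standard_of_hypotheses (hF : IsFrobenioid F) (hΦ : IsPerfFactorialOn Φ)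
    (hH : ModelFrobenioid.Hypotheses (rlfFunctor Φ (IsPerfFactorialOn.op hΦ))
      ((RealificationData.canonical Φ (IsPerfFactorialOn.op hΦ)).realSpan (biratSubfunctor F)).toMonoid) :
    Prop55iii_untr_rlf_standard F hF hΦ :=
  prop55iii_untr_rlf_standard_of F hF hΦ hH fun hS =>
    isNonDilatingOn_rlfFunctor Φ (IsPerfFactorialOn.op hΦ)
      -- the statement files' `IsNonDilatingOn` (conclusion `∀ a, α^char a = a`) ⇒ found's (`α^char = id`)
      fun X f hle => MonoidHom.ext (hS.nonDilating X f hle)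

end FrdI.Prop55Sub

end Literature.AlgebraicGeometry.Frobenioids
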